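import Literature.Computability.FineGrained.DTWReductionLoops
import Literature.Computability.FineGrained.DiameterOVReduction
import Literature.Computability.FineGrained.SETHHardness
import HarnessLib

/-!
# SETH-hardness of DTW on one-dimensional curves: the run, the word size, the time, and the proof of fine-grained.S15 (DTW)

The proof of the named fact `not_dtw_inTimeO_of_sethWordRAM` of `…FineGrained.SETHHardness`
(K. Bringmann, M. Künnemann, *Quadratic conditional lower bounds for string problems and dynamic
time warping*, FOCS 2015, Thm. 1.1: DTW on one-dimensional curves with values in `{0, …, O(n)}`
— here `(DTW c)`, entries at most `N^c`, any `c ≥ 1` — has no `O(n^{2-ε})` algorithm unless SETH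
fails; the statement file's docstring attributes the same sentence to Abboud–Backurs–Vassilevska
Williams, FOCS 2015, Thm. 1, whose DTW result is for curves of *symbols*, and cites BK15 as
"Thm. 1.2", which in the published numbering is the edit-distance/LCS theorem; the one-dimensional
DTW statement formalised here is BK15 Thm. 1.1). With the build of `…DTWReductionLoops` in hand
this file completes the OV algorithm extracted from a subquadratic DTW algorithm:

* **the run** (`DTWRed.Prog.Params.reduction_outputsWithin`): the emulator's side conditions
  (`envOK`), the target invariant and the agreement of the emulated memory with the initial memory
  of the DTW program on `dtwInput I` (`tinv_finMem`, `agree_finMem`), the read-out (`post_spec`: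
  the bit `[v + 1 < thr']`), whence by `SProg.outputsWithin_withSubrun` the OV program outputs
  `[1]` iff `v + 1 < thr'` iff (`n ≥ 1` and `dtw(x, y) ≤ thr I`) iff an orthogonal pair exists
  (`DTWRed.toNat_dtwDist_ov_le_thr_iff`), within `Tpre + 38 T + 6` steps;
* **the word size** (`kfit`, `fits`) and **the time** (`Tpre_le`, `Ttotal_le`): the build is
  linear in `|x| + |y| ≤ 2000 (n+1)(d+1)` and the emulated run costs
  `38 (C (|x|+|y|)^{2-ε} + C) = O((n+1)^{2-ε} (d+1)^2)`;
* **the theorems**: `ovInTimePolyDim_of_dtw_inTimeO` (BK15 Thm. 3.3 instantiated by §6 and read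
  on the word RAM: a deterministic `O(N^{2-ε})` word-RAM algorithm for `DTW c`, `0 < ε ≤ 1`,
  `c ≥ 1`, gives `OVInTimePolyDim ε`), `not_dtw_inTimeO_of_ovhWordRAM` (OVH version, BK15 §2.1),
  and the discharge `not_dtw_inTimeO_of_sethWordRAM_holds` via word-RAM SETH ⇒ OVH
  (`ovhWordRAM_of_sethWordRAM_of kSATInRAMTime_of_ovInTimePolyDim_holds`, Williams' split-and-list
  reduction, `OVPolyDimProofs.lean`).

## References

* K. Bringmann, M. Künnemann, FOCS 2015 (arXiv:1502.01063), Thm. 1.1, §2.1 (OVH, Lemma 2.1),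
  Thm. 3.3 (proof §3.1), §6 (DTW: Lemmas 6.2, 6.3, 6.6).
* A. Abboud, A. Backurs, V. Vassilevska Williams, FOCS 2015, Thm. 1 (DTW over symbols).
* V. Vassilevska Williams, Proc. ICM 2018, §2 (the word RAM).
-/

namespace Literature.Computability.FineGrained

open Cryptography Cryptography.WordRAM Complexity Cryptography.WordRAM.SProg

namespace DTWRed

namespace Prog

namespace Params

variable (g : Params) {W : ℕ} {O : List ℕ → List ℕ}

/-! ### The run -/

/-- The emulator's side conditions hold for the layout and the environment `g.env`. [folklore] -/
theorem envOK (hF : g.Fits W) : EnvOK lay g.env W := by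
  obtain ⟨hX, hXLx, hBv, hSv, htop, hNyV, hPwV, hcDV, hLx, edd, eL, eK1, eLX, eLY, eK2, eper, eperY, eLK,
    elenX, elenY, eNy, eM1, eM2, eB0, eSVG, erho1, eSNVG, esig3, ethr, h12, hSVG, hSNVG, hL1, hA, hrho,
    hrs, hK2A, hLXA, hMK, hnrho, hnsig⟩ := g.facts hF
  refine ⟨by decide, by decide, by decide, by decide, by decide, by decide, by decide,
    fun r hr => ?_, Or.inl ?_, ?_, ?_, hF.ws_lt.le⟩
  · simp only [lay, Layout.regs, List.mem_cons, List.not_mem_nil, or_false] at hr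
    show r < g.Bv ∧ r < g.Sv
    rcases hr with rfl | rfl | rfl | rfl | rfl | rfl | rfl <;> omega
  · show g.Bv + (g.V + 1) ≤ g.Sv; omega
  · show g.Bv + (g.V + 1) ≤ 2 ^ W; omega
  · show g.Sv + (g.V + 1) ≤ 2 ^ W; omega

/-- Every emulated cell is below `Pw`. [folklore] -/
theorem ycell_lt (j : ℕ) : g.ycell j < g.Pw := by
  unfold ycell; split_ifs <;> exact Nat.mod_lt _ Nat.one_le_two_pow

/-- Every cell of the final memory is below `2 ^ W`. [folklore] -/
theorem finMem_lt (hF : g.Fits W) (a : ℕ) : g.finMem a < 2 ^ W := by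
  obtain ⟨hX, hXLx, hBv, hSv, htop, hNyV, hPwV, hcDV, hLx, edd, eL, eK1, eLX, eLY, eK2, eper, eperY, eLK,
    elenX, elenY, eNy, eM1, eM2, eB0, eSVG, erho1, eSNVG, esig3, ethr, h12, hSVG, hSNVG, hL1, hA, hrho,
    hrs, hK2A, hLXA, hMK, hnrho, hnsig⟩ := g.facts hF
  unfold finMem
  by_cases ha : a < 100
  · rw [if_pos ha]; split_ifs <;> omega
  rw [if_neg ha]
  unfold finData
  split_ifs
  · exact lt_of_le_of_lt (CliqueRed.relocated_le_of_forall (B := 2 ^ W - 1)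
      (fun v hv => Nat.le_sub_one_of_lt (hF.input v hv)) (by omega)) (by omega)
  · exact (g.ycell_lt _).trans_le (by omega)
  · exact Nat.two_pow_pos W

/-- The stamps are untouched: `0` from `Sv` on. [folklore] -/
theorem finMem_Sv_add (hF : g.Fits W) (a : ℕ) : g.finMem (g.Sv + a) = 0 := by
  obtain ⟨hX, hXLx, hBv, hSv, htop, hNyV, hPwV, hcDV, hLx, edd, eL, eK1, eLX, eLY, eK2, eper, eperY, eLK,
    elenX, elenY, eNy, eM1, eM2, eB0, eSVG, erho1, eSNVG, esig3, ethr, h12, hSVG, hSNVG, hL1, hA, hrho,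
    hrs, hK2A, hLXA, hMK, hnrho, hnsig⟩ := g.facts hF
  unfold finMem finData
  rw [if_neg (by omega), if_neg (by omega), if_neg (by omega)]

/-- **The target invariant at the end of the build.** [folklore] -/
theorem tinv_finMem (hF : g.Fits W) : TInv lay g.env (2 ^ W - 1) g.finMem := by
  refine ⟨⟨?_, ?_, ?_, ?_⟩, fun a _ => ?_, fun a => Nat.le_sub_one_of_lt (g.finMem_lt hF a)⟩
  · show g.finMem 10 = g.Bv; simp [finMem]
  · show g.finMem 11 = g.Sv; simp [finMem]
  · show g.finMem 12 = 0; simp [finMem]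
  · show g.finMem 13 = 2 ^ g.ws; simp [finMem]; rfl
  · show g.finMem (g.Sv + a) ≤ 0
    rw [g.finMem_Sv_add hF a]

/-- **The emulated input is in place at the end of the build**: below the region size, the
emulated memory is the initial memory of the DTW program on `y = dtwInput I` at word size `ws`.
[folklore] -/
theorem agree_finMem (hF : g.Fits W) : Agree g.env g.finMem (init g.ws g.y).mem := by
  obtain ⟨hX, hXLx, hBv, hSv, htop, hNyV, hPwV, hcDV, hLx, edd, eL, eK1, eLX, eLY, eK2, eper, eperY, eLK,
    elenX, elenY, eNy, eM1, eM2, eB0, eSVG, erho1, eSNVG, esig3, ethr, h12, hSVG, hSNVG, hL1, hA, hrho,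
    hrs, hK2A, hLXA, hMK, hnrho, hnsig⟩ := g.facts hF
  have hlen : g.y.length = g.Ny := g.length_y
  intro a _
  have hstamp : g.finMem (g.Sv + a) = 0 := g.finMem_Sv_add hF a
  show (if g.finMem (g.Sv + a) = 0 then g.finMem (g.Bv + a) else 0) = (init g.ws g.y).mem a
  rw [if_pos hstamp]
  unfold finMem finData
  rw [if_neg (by omega), if_neg (by omega), Nat.add_sub_cancel_left]
  rcases Nat.lt_or_ge a (g.Ny + 1) with ha | ha
  · rw [if_pos (by omega)]
    unfold ycell
    rcases Nat.eq_zero_or_pos a with rfl | hpos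
    · rw [if_pos rfl, init_mem_zero, hlen]; rfl
    · obtain ⟨j, rfl⟩ := Nat.exists_eq_add_of_le' hpos
      rw [if_neg (by omega), Nat.add_sub_cancel, init_mem_succ _ _ _ (by omega),
        List.getD_eq_getElem _ _ (by omega)]; rfl
  · rw [if_neg (by omega), init_mem_of_length_lt _ _ _ (by omega)]

/-- **The read-out.** From any memory agreeing with the halting memory `dm` of the DTW program
(target invariant kept, `dm 1 + 1` a word), `post` outputs the bit `[dm 1 + 1 < thr']` in `5` steps.
[folklore] -/
theorem post_spec (hF : g.Fits W) {m₂ dm : ℕ → ℕ} (hag : Agree g.env m₂ dm)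
    (hI : TInv lay g.env (2 ^ W - 1) m₂) (h25 : m₂ 25 = g.thr') (hv : dm 1 + 1 < 2 ^ W)
    (qs : List (List ℕ)) :
    ∃ (st₃ : Store) (t₃ : ℕ), t₃ ≤ 5 ∧ Exec W O post ⟨m₂, qs⟩ st₃ t₃ ∧
      readOut st₃.mem = [if dm 1 + 1 < g.thr' then 1 else 0] := by
  obtain ⟨hX, hXLx, hBv, hSv, htop, hNyV, hPwV, hcDV, hLx, edd, eL, eK1, eLX, eLY, eK2, eper, eperY, eLK,
    elenX, elenY, eNy, eM1, eM2, eB0, eSVG, erho1, eSNVG, esig3, ethr, h12, hSVG, hSNVG, hL1, hA, hrho,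
    hrs, hK2A, hLXA, hMK, hnrho, hnsig⟩ := g.facts hF
  have h10 : m₂ 10 = g.Bv := hI.env.1
  have hst : m₂ (g.Sv + 1) = 0 := Nat.le_zero.1 (hI.stamp 1 (by show 1 < g.V + 1; omega))
  have h1 : m₂ (g.Bv + 1) = dm 1 := by
    have := hag 1 (by show 1 < g.V + 1; omega)
    simp only [edec, Params.env, hst, if_true] at this
    exact this
  have hW1 : 1 ≤ W := by have := hF.ws_lt; omega
  have h2W : 2 ≤ 2 ^ W := by
    calc (2 : ℕ) = 2 ^ 1 := rfl
      _ ≤ 2 ^ W := Nat.pow_le_pow_right (by norm_num) hW1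
  refine ⟨_, 5, le_rfl, Exec.block _ m₂ qs, ?_⟩
  have hm : execOps W m₂ [(.add, r 17, r 10, im 1), (.band, r 17, pt 17, pt 17), (.add, r 17, r 17, im 1),
      (.lt, r 1, r 17, r 25), (.band, r 0, im 1, im 1)] =
      Function.update (Function.update (Function.update (Function.update (Function.update m₂ 17 (g.Bv + 1))
        17 (dm 1)) 17 (dm 1 + 1)) 1 (if dm 1 + 1 < g.thr' then 1 else 0)) 0 1 := by
    simp (disch := first | omega | decide) only [execOps_cons, execOps_nil, execOp, Operand.write,
      Operand.read, Function.update_self, Function.update_of_ne, h10, h1, h25, BinOp.eval_add_of_lt,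
      BinOp.eval_band, BinOp.eval_lt, Nat.and_self]
  show readOut (execOps W m₂ _) = _
  rw [hm]
  simp [readOut, readSeg, Function.update_self, Function.update_of_ne]

/-- The total time of the OV program, given a time bound `T` for the DTW program. [folklore] -/
noncomputable def Ttotal (T : ℕ) : ℕ := g.Tpre + cstep * T + 6

/-- **The OV program's output.** At a word size `W` with `g.Fits W`, if the deterministic
oracle-free DTW program `M` (largest constant `cD`) outputs `[v]` on `dtwInput I` at word size
`ws = kD · size Ny` within `T` steps (`v + 1` a word), then the OV program outputs `[1]` if `v + 1 < thr'` and `[0]`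
otherwise, on `x = OV.encode I`, within `Tpre + 38 T + 6` steps. [folklore] -/
theorem reduction_outputsWithin (hF : g.Fits W) {M : Program} (hdet : M.IsDeterministic)
    (hof : M.IsOracleFree) (hcD : M.maxConst = g.cD) {T v : ℕ} (hvW : v + 1 < 2 ^ W)
    (hM : OutputsWithin M g.ws noOracle zeroCoins g.y [v] T) :
    OutputsWithin (reduction M g.kD) W noOracle zeroCoins g.x
      [if v + 1 < g.thr' then 1 else 0] (g.Ttotal T) := by
  obtain ⟨hX, hXLx, hBv, hSv, htop, hNyV, hPwV, hcDV, hLx, edd, eL, eK1, eLX, eLY, eK2, eper, eperY, eLK,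
    elenX, elenY, eNy, eM1, eM2, eB0, eSVG, erho1, eSNVG, esig3, ethr, h12, hSVG, hSNVG, hL1, hA, hrho,
    hrs, hK2A, hLXA, hMK, hnrho, hnsig⟩ := g.facts hF
  have hW1 : 1 ≤ W := by have := hF.ws_lt; omega
  have h2W : 2 ≤ 2 ^ W := by
    calc (2 : ℕ) = 2 ^ 1 := rfl
      _ ≤ 2 ^ W := Nat.pow_le_pow_right (by norm_num) hW1
  obtain ⟨st₁, t₁, ht₁, hexec, hmem, hqs⟩ := (g.pre_spec (O := noOracle) hF).exists_exec
  obtain ⟨dh, hhalt, hout⟩ := (outputsWithin_iff_exists_haltsWithin _ _ _ _ _ _ _).1 hM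
  have hst₁ : st₁ = ⟨g.finMem, []⟩ := by cases st₁; simp only at hmem hqs; rw [hmem, hqs]
  subst hst₁
  unfold reduction
  rw [hcD]
  have key := outputsWithin_withSubrun (O := noOracle) zeroCoins (pre := pre g.kD g.cD)
    (post := post) (L := lay) (E := g.env) (VT := 2 ^ W - 1) (V := g.V) (M := M) (x := g.x)
    (y := g.y) (out := [if v + 1 < g.thr' then 1 else 0]) (T₂ := 5) hF.width hexec (g.envOK hF)
    (by omega) (by omega)
    (fun r hr => by
      simp only [lay, Layout.regs, List.mem_cons, List.not_mem_nil, or_false] at hr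
      rcases hr with rfl | rfl | rfl | rfl | rfl | rfl | rfl <;> omega)
    hdet hof (by rw [hcD]; omega) (by show g.V < g.V + 1; omega) (by omega)
    (by show 2 ^ g.ws - 1 ≤ g.V; have := g.le_V; unfold Pw at this; omega) (by omega)
    (g.tinv_finMem hF) (g.agree_finMem hF) hhalt
    (fun m₂ hag hI hfoot => by
      have h25 : m₂ 25 = g.thr' := by
        rw [hfoot 25 (by
          unfold Foot
          rintro (h | h | h | h | h)
          · exact absurd h (by decide)
          · exact absurd h (by decide)
          · exact absurd h (by decide)
          · exact absurd h.1 (by show ¬ g.Bv ≤ 25; omega)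
          · exact absurd h.1 (by show ¬ g.Sv ≤ 25; omega))]
        simp [finMem]
      have h1v := CliqueRed.mem_one_of_readOut hout
      have := g.post_spec (O := noOracle) hF hag hI h25 (by rw [h1v]; exact hvW) []
      rwa [h1v] at this)
  exact key.mono (by unfold Ttotal; omega)


/-! ### The word size -/

/-- **The word-size constant** of the OV program: with `W = kfit · inputWidth x` every address and
value of the run fits (`fits`). [folklore] -/
def _root_.Literature.Computability.FineGrained.DTWRed.Prog.kfit (kD cD : ℕ) : ℕ :=
  14 * kD + Nat.size (2 * cD + 109) + 40

/-- `(n+1)(d+1) < 4 · 2^w` for the input width `w`: `n, d` and `2 + 2nd` are below `2^w`. [folklore] -/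
theorem succ_mul_succ_lt : (g.I.n + 1) * (g.I.d + 1) < 4 * 2 ^ inputWidth g.x := by
  have hLx : g.Lx < 2 ^ inputWidth g.x := length_lt_two_pow_inputWidth _
  rw [g.Lx_eq] at hLx
  have hn : g.I.n < 2 ^ inputWidth g.x :=
    lt_two_pow_inputWidth_of_mem _ _ (by unfold x; rw [OV_encode_eq]; simp)
  have hd : g.I.d < 2 ^ inputWidth g.x :=
    lt_two_pow_inputWidth_of_mem _ _ (by unfold x; rw [OV_encode_eq]; simp)
  change 2 + 2 * (g.I.n * g.I.d) < _ at hLx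
  nlinarith

/-- `Ny ≤ 2001 (n+1)(d+1)`. [folklore] -/
theorem Ny_le : g.Ny ≤ 2001 * ((g.I.n + 1) * (g.I.d + 1)) := by
  obtain ⟨-, -, h, -⟩ := length_ov_bounds g.I
  unfold Ny lenX lenY
  nlinarith

/-- `|x| + |y| ≤ 2000 (n+1)(d+1)`. [folklore] -/
theorem lenX_add_lenY_le : g.lenX + g.lenY ≤ 2000 * ((g.I.n + 1) * (g.I.d + 1)) := by
  obtain ⟨-, -, h, -⟩ := length_ov_bounds g.I
  unfold lenX lenY; rw [Nat.mul_assoc] at h; exact h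

/-- `Ny < 2^(w + 13)`. [folklore] -/
theorem Ny_lt : g.Ny < 2 ^ (inputWidth g.x + 13) := by
  have h := g.succ_mul_succ_lt
  have hNy := g.Ny_le
  rw [Nat.pow_add]
  norm_num
  omega

/-- `ws ≤ 14 kD w`. [folklore] -/
theorem ws_le : g.ws ≤ 14 * g.kD * inputWidth g.x := by
  have hw1 : 1 ≤ inputWidth g.x := inputWidth_pos _
  have hsz : Nat.size g.Ny ≤ inputWidth g.x + 13 := Nat.size_le.2 g.Ny_lt
  unfold ws
  calc g.kD * Nat.size g.Ny ≤ g.kD * (inputWidth g.x + 13) := Nat.mul_le_mul_left _ hsz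
    _ ≤ g.kD * (14 * inputWidth g.x) := Nat.mul_le_mul_left _ (by omega)
    _ = 14 * g.kD * inputWidth g.x := by ring

/-- `ℓx M₂ ≤ 2500 (d+1)²` and `M₂ ≤ 48 (d+1)`. [folklore] -/
theorem LXM2_le : g.LX * g.M2 ≤ 2500 * ((g.I.d + 1) * (g.I.d + 1)) ∧ g.M2 ≤ 48 * (g.I.d + 1) := by
  obtain ⟨k, edd, -, -, -, -, -, -, eM2, -, -, eLM, -⟩ := g.poly
  have hk : g.I.d + 1 = k + 1 := by rw [← edd]; rfl
  rw [eLM, eM2, hk]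
  constructor <;> nlinarith

/-- The arithmetic of the setup fits: `(n+1) ℓx M₂ < 2^(2w + 14)`. [folklore] -/
theorem arith_lt : (g.n + 1) * (g.LX * g.M2) < 2 ^ (2 * inputWidth g.x + 14) := by
  have h := g.succ_mul_succ_lt
  have hA := g.LXM2_le.1
  have hd : g.I.d < 2 ^ inputWidth g.x :=
    lt_two_pow_inputWidth_of_mem _ _ (by unfold x; rw [OV_encode_eq]; simp)
  set T := 2 ^ inputWidth g.x with hT
  have hT0 : 0 < T := Nat.two_pow_pos _
  have e : 2 ^ (2 * inputWidth g.x + 14) = 16384 * (T * T) := by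
    rw [Nat.pow_add, Nat.two_mul, Nat.pow_add]; norm_num; ring
  rw [e]
  calc (g.n + 1) * (g.LX * g.M2) ≤ (g.I.n + 1) * (2500 * ((g.I.d + 1) * (g.I.d + 1))) :=
        Nat.mul_le_mul_left _ hA
    _ = 2500 * (((g.I.n + 1) * (g.I.d + 1)) * (g.I.d + 1)) := by ring
    _ ≤ 2500 * (((g.I.n + 1) * (g.I.d + 1)) * T) :=
        Nat.mul_le_mul_left _ (Nat.mul_le_mul_left _ (by omega))
    _ < 2500 * ((4 * T) * T) :=
        Nat.mul_lt_mul_of_pos_left (Nat.mul_lt_mul_of_pos_right h hT0) (by norm_num)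
    _ ≤ 16384 * (T * T) := by
        rw [show 2500 * (4 * T * T) = 10000 * (T * T) by ring]
        exact Nat.mul_le_mul_right _ (by norm_num)

/-- The DTW value fits: `Ny M₂ + 1 < 2^(2w + 20)`. [folklore] -/
theorem NyM2_lt : g.Ny * g.M2 + 1 < 2 ^ (2 * inputWidth g.x + 20) := by
  have h := g.succ_mul_succ_lt
  have hNy := g.Ny_le
  have hM := g.LXM2_le.2
  have hd : g.I.d < 2 ^ inputWidth g.x :=
    lt_two_pow_inputWidth_of_mem _ _ (by unfold x; rw [OV_encode_eq]; simp)
  have e : 2 ^ (2 * inputWidth g.x + 20) = 1048576 * (2 ^ inputWidth g.x * 2 ^ inputWidth g.x) := by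
    rw [Nat.pow_add, Nat.two_mul, Nat.pow_add]; norm_num; ring
  rw [e]
  have h1 : g.Ny * g.M2 ≤ 2001 * 48 * (((g.I.n + 1) * (g.I.d + 1)) * (g.I.d + 1)) := by
    calc g.Ny * g.M2 ≤ (2001 * ((g.I.n + 1) * (g.I.d + 1))) * (48 * (g.I.d + 1)) := Nat.mul_le_mul hNy hM
      _ = _ := by ring
  have h2 : ((g.I.n + 1) * (g.I.d + 1)) * (g.I.d + 1) < (4 * 2 ^ inputWidth g.x) * 2 ^ inputWidth g.x :=
    Nat.mul_lt_mul_of_lt_of_le h (by omega) (by positivity)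
  nlinarith [Nat.one_le_two_pow (n := inputWidth g.x)]

/-- **The word size fits.** The run at word size `kfit · inputWidth x` satisfies `Fits`, and the
DTW value plus one is a word. [folklore] -/
theorem fits : g.Fits (kfit g.kD g.cD * inputWidth g.x) ∧ g.Ny * g.M2 + 1 < 2 ^ (kfit g.kD g.cD * inputWidth g.x) := by
  set w := inputWidth g.x with hw
  have hw1 : 1 ≤ w := inputWidth_pos _
  have hLx : g.Lx < 2 ^ w := length_lt_two_pow_inputWidth _
  have hNy : g.Ny < 2 ^ (w + 13) := g.Ny_lt
  have hws : g.ws ≤ 14 * g.kD * w := g.ws_le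
  set E := 14 * g.kD * w + (w + 13) with hE
  have h2E : ∀ t, t ≤ E → 2 ^ t ≤ 2 ^ E := fun t ht => Nat.pow_le_pow_right Nat.two_pos ht
  have hPw : g.Pw ≤ 2 ^ E := h2E _ (by omega)
  have hLxE : g.Lx ≤ 2 ^ E := hLx.le.trans (h2E _ (by omega))
  have hNyE : g.Ny ≤ 2 ^ E := hNy.le.trans (h2E _ (by omega))
  set A := 2 * g.cD + 109 with hA
  -- the top of the stamp region
  have htop : g.Sv + g.V + 1 ≤ A * 2 ^ E := by
    have e : g.Sv + g.V + 1 ≤ 2 * g.Lx + 2 * g.Pw + 2 * g.cD + 2 * g.Ny + 101 := by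
      unfold Sv Bv X V; have := (Nat.one_le_two_pow : 1 ≤ g.Pw); unfold Pw at this ⊢; omega
    refine e.trans ?_
    have e1 : 2 * g.Lx ≤ 2 * 2 ^ E := by omega
    have e2 : 2 * g.Pw ≤ 2 * 2 ^ E := by omega
    have e3 : 2 * g.cD ≤ 2 * g.cD * 2 ^ E := CliqueRed.le_self_mul_two_pow _ _
    have e4 : 2 * g.Ny ≤ 2 * 2 ^ E := by omega
    have e5 : 101 ≤ 103 * 2 ^ E := le_trans (by norm_num) (CliqueRed.le_self_mul_two_pow 103 E)
    have hsum := CliqueRed.add_le_mul_two_pow (CliqueRed.add_le_mul_two_pow (CliqueRed.add_le_mul_two_pow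
      (CliqueRed.add_le_mul_two_pow e1 e2) e3) e4) e5
    rw [show 2 + 2 + 2 * g.cD + 2 + 103 = A by rw [hA]; ring] at hsum
    exact hsum
  have htot : g.Sv + g.V + 1 ≤ 2 ^ (Nat.size A + E) := htop.trans (CliqueRed.mul_two_pow_le_two_pow_size_add A E)
  -- the word size
  set sA := Nat.size A with hsA
  have hkfit : kfit g.kD g.cD = 14 * g.kD + sA + 40 := rfl
  have hW : sA + E + 1 ≤ kfit g.kD g.cD * w ∧ 2 * w + 20 ≤ kfit g.kD g.cD * w := by
    rw [hkfit, hE, Nat.add_mul, Nat.add_mul]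
    have h1 : sA ≤ sA * w := Nat.le_mul_of_pos_right _ hw1
    have h2 : 40 * w = w + w + w + 37 * w := by ring
    constructor <;> omega
  have hk1 : w ≤ kfit g.kD g.cD * w :=
    calc w = 1 * w := (one_mul _).symm
      _ ≤ kfit g.kD g.cD * w := Nat.mul_le_mul_right _ (by rw [hkfit]; omega)
  have harith := g.arith_lt
  have hNyM2 := g.NyM2_lt
  refine ⟨⟨htot.trans (Nat.pow_le_pow_right Nat.two_pos (by omega)), by omega, hk1,
    harith.trans_le (Nat.pow_le_pow_right Nat.two_pos (by omega))⟩,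
    hNyM2.trans_le (Nat.pow_le_pow_right Nat.two_pos (by omega))⟩

/-! ### The time -/

/-- **The running time of the build**, linear in `(n+1)(d+1)`. [folklore] -/
theorem Tpre_le : g.Tpre ≤ 101000 * ((g.I.n + 1) * (g.I.d + 1)) := by
  have hLx := g.Lx_eq
  have hNy := g.Ny_le
  have hS := g.lenX_add_lenY_le
  have hsz : Nat.size g.Ny ≤ g.Ny := CliqueRed.size_le_self _
  have hprod : (g.I.n + 1) * (g.I.d + 1) = g.I.n * g.I.d + g.I.n + g.I.d + 1 := by ring
  change g.Lx = 2 + 2 * (g.I.n * g.I.d) at hLx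
  unfold Tpre
  omega

/-- The real-number bookkeeping: for `0 < ε ≤ 1`,
`Tpre + 38 ⌊C (|x|+|y|)^{2-ε} + C⌋₊ + 6 ≤ (101006 + 152000038 max C 0) (n+1)^{2-ε} (d+1)^2`. [folklore] -/
theorem Ttotal_le {ε : ℝ} (hε : 0 < ε) (hε1 : ε ≤ 1) (C : ℝ) :
    ((g.Ttotal ⌊C * (((g.lenX + g.lenY : ℕ) : ℝ)) ^ (2 - ε) + C⌋₊ : ℕ) : ℝ) ≤
      (101006 + 152000038 * max C 0) * ((((g.I.n : ℝ) + 1) ^ (2 - ε)) * ((g.I.d : ℝ) + 1) ^ (2 : ℕ)) := by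
  set C₀ := max C 0 with hC₀
  have hC₀0 : 0 ≤ C₀ := le_max_right _ _
  have hCC₀ : C ≤ C₀ := le_max_left _ _
  set a : ℝ := (g.I.n : ℝ) + 1 with ha
  set b : ℝ := (g.I.d : ℝ) + 1 with hb
  have ha1 : 1 ≤ a := by rw [ha]; have := (Nat.cast_nonneg g.I.n : (0:ℝ) ≤ g.I.n); linarith
  have hb1 : 1 ≤ b := by rw [hb]; have := (Nat.cast_nonneg g.I.d : (0:ℝ) ≤ g.I.d); linarith
  have ha0 : 0 ≤ a := by linarith
  have hb0 : 0 ≤ b := by linarith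
  set P : ℝ := a ^ (2 - ε) * b ^ (2 : ℕ) with hP
  have haP : a ≤ a ^ (2 - ε) := by
    calc a = a ^ (1 : ℝ) := (Real.rpow_one a).symm
      _ ≤ a ^ (2 - ε) := Real.rpow_le_rpow_of_exponent_le ha1 (by linarith)
  have hbP : b ≤ b ^ (2 : ℕ) := by nlinarith
  have hab : a * b ≤ P := mul_le_mul haP hbP hb0 (le_trans ha0 haP)
  have h1P : 1 ≤ P := le_trans (by nlinarith) hab
  have hP0 : 0 ≤ P := by linarith
  -- the DTW program's time
  set S : ℕ := g.lenX + g.lenY with hS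
  have hSle : ((S : ℕ) : ℝ) ≤ 2000 * (a * b) := by
    have := g.lenX_add_lenY_le; rw [ha, hb]; exact_mod_cast this
  have hS0 : (0 : ℝ) ≤ ((S : ℕ) : ℝ) := Nat.cast_nonneg _
  have hpow : ((S : ℕ) : ℝ) ^ (2 - ε) ≤ 4000000 * P := by
    calc ((S : ℕ) : ℝ) ^ (2 - ε) ≤ (2000 * (a * b)) ^ (2 - ε) := Real.rpow_le_rpow hS0 hSle (by linarith)
      _ = (2000 : ℝ) ^ (2 - ε) * (a ^ (2 - ε) * b ^ (2 - ε)) := by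
          rw [Real.mul_rpow (by norm_num) (by positivity), Real.mul_rpow ha0 hb0]
      _ ≤ 4000000 * (a ^ (2 - ε) * b ^ (2 : ℕ)) := by
          have h2 : (2000 : ℝ) ^ (2 - ε) ≤ 4000000 := by
            calc (2000 : ℝ) ^ (2 - ε) ≤ (2000 : ℝ) ^ (2 : ℝ) :=
                  Real.rpow_le_rpow_of_exponent_le (by norm_num) (by linarith)
              _ = 4000000 := by norm_num
          have hb2 : b ^ (2 - ε) ≤ b ^ (2 : ℕ) := by
            calc b ^ (2 - ε) ≤ b ^ ((2 : ℕ) : ℝ) := Real.rpow_le_rpow_of_exponent_le hb1 (by norm_num; linarith)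
              _ = b ^ (2 : ℕ) := Real.rpow_natCast b 2
          have ha2 : 0 ≤ a ^ (2 - ε) := Real.rpow_nonneg ha0 _
          have hbb : 0 ≤ b ^ (2 - ε) := Real.rpow_nonneg hb0 _
          calc (2000 : ℝ) ^ (2 - ε) * (a ^ (2 - ε) * b ^ (2 - ε)) ≤ 4000000 * (a ^ (2 - ε) * b ^ (2 - ε)) :=
                mul_le_mul_of_nonneg_right h2 (mul_nonneg ha2 hbb)
            _ ≤ 4000000 * (a ^ (2 - ε) * b ^ (2 : ℕ)) := by
                apply mul_le_mul_of_nonneg_left _ (by norm_num)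
                exact mul_le_mul_of_nonneg_left hb2 ha2
  have hTM : ((⌊C * ((S : ℕ) : ℝ) ^ (2 - ε) + C⌋₊ : ℕ) : ℝ) ≤ C₀ * (4000000 * P) + C₀ := by
    have hr0 : (0 : ℝ) ≤ ((S : ℕ) : ℝ) ^ (2 - ε) := Real.rpow_nonneg hS0 _
    rcases le_or_gt 0 (C * ((S : ℕ) : ℝ) ^ (2 - ε) + C) with h0 | h0
    · calc ((⌊C * ((S : ℕ) : ℝ) ^ (2 - ε) + C⌋₊ : ℕ) : ℝ) ≤ C * ((S : ℕ) : ℝ) ^ (2 - ε) + C :=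
            Nat.floor_le h0
        _ ≤ C₀ * ((S : ℕ) : ℝ) ^ (2 - ε) + C₀ := add_le_add (mul_le_mul_of_nonneg_right hCC₀ hr0) hCC₀
        _ ≤ C₀ * (4000000 * P) + C₀ := by nlinarith [mul_le_mul_of_nonneg_left hpow hC₀0]
    · rw [Nat.floor_of_nonpos h0.le]; simp; nlinarith
  -- the build
  have hpre : (g.Tpre : ℝ) ≤ 101000 * (a * b) := by
    have := g.Tpre_le; rw [ha, hb]; exact_mod_cast this
  unfold Ttotal cstep
  push_cast
  nlinarith [hab, h1P, hTM, hpre, mul_nonneg hC₀0 hP0]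

end Params

end Prog

/-! ### A crude upper bound on the DTW value -/

/-- A sum of distances to points in `[0, B]` from a point in `[0, B]` is at most `|L| · B`.
[folklore] -/
theorem sum_map_natAbs_le (B : ℕ) (c : ℤ) (hc : 0 ≤ c ∧ c ≤ B) :
    ∀ (L : List ℤ), (∀ v ∈ L, 0 ≤ v ∧ v ≤ B) →
      (L.map fun v => ((v - c).natAbs : ℕ∞)).sum ≤ ((L.length * B : ℕ) : ℕ∞) ∧
      (L.map fun v => ((c - v).natAbs : ℕ∞)).sum ≤ ((L.length * B : ℕ) : ℕ∞)
  | [], _ => by simp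
  | v :: L, h => by
    have hv := h v (by simp)
    have ih := sum_map_natAbs_le B c hc L (fun w hw => h w (by simp [hw]))
    have h1 : (v - c).natAbs ≤ B := by omega
    have h2 : (c - v).natAbs ≤ B := by omega
    simp only [List.map_cons, List.sum_cons, List.length_cons]
    rw [show ((L.length + 1) * B : ℕ) = B + L.length * B by ring]
    push_cast
    exact ⟨add_le_add (by exact_mod_cast h1) (by exact_mod_cast ih.1),
      add_le_add (by exact_mod_cast h2) (by exact_mod_cast ih.2)⟩

/-- **Crude upper bound**: two nonempty sequences with points in `[0, B]` are at DTW distance at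
most `(|x| + |y|) · B` (couple all of `x` but its last point with `y`'s first point, then the
last point of `x` with all of `y`). [folklore] -/
theorem dtwDist_le_length_mul {x y : List ℤ} {B : ℕ} (hx : x ≠ []) (hy : y ≠ [])
    (h : ∀ v ∈ x ++ y, 0 ≤ v ∧ v ≤ B) :
    dtwDist x y ≤ (((x.length + y.length) * B : ℕ) : ℕ∞) := by
  obtain ⟨c, C, rfl⟩ := List.exists_cons_of_ne_nil hy
  have hxv : ∀ v ∈ x, 0 ≤ v ∧ v ≤ B := fun v hv => h v (List.mem_append_left _ hv)
  have hyv : ∀ v ∈ c :: C, 0 ≤ v ∧ v ≤ B := fun v hv => h v (List.mem_append_right _ hv)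
  have hc : 0 ≤ c ∧ c ≤ B := hyv c (by simp)
  -- split `x` before its last point
  have hlen : 1 ≤ x.length := List.length_pos_iff.2 hx
  have hdrop : x.drop (x.length - 1) ≠ [] := by
    intro h0; have := congrArg List.length h0; simp at this; omega
  obtain ⟨a, A, hA⟩ := List.exists_cons_of_ne_nil hdrop
  have hA1 : A = [] := by
    have := congrArg List.length hA; simp at this
    exact List.eq_nil_of_length_eq_zero (by omega)
  subst hA1
  have ha : 0 ≤ a ∧ a ≤ B := hxv a (by
    have : a ∈ x.drop (x.length - 1) := by rw [hA]; simp
    exact List.mem_of_mem_drop this)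
  have h1 := dtwDist_le_sum_take_add_drop x (x.length - 1) c C
  rw [hA, dtwDist_singleton_left a (c :: C) (by simp)] at h1
  have s1 := (sum_map_natAbs_le B c hc (x.take (x.length - 1))
    (fun v hv => hxv v (List.mem_of_mem_take hv))).1
  have s2 := (sum_map_natAbs_le B a ha (c :: C) hyv).2
  refine h1.trans ((add_le_add s1 s2).trans ?_)
  have ht : (x.take (x.length - 1)).length ≤ x.length := by
    rw [List.length_take]; exact min_le_right _ _
  have : (x.take (x.length - 1)).length * B + (c :: C).length * B ≤ (x.length + (c :: C).length) * B := by
    rw [Nat.add_mul]; exact Nat.add_le_add_right (Nat.mul_le_mul_right _ ht) _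
  exact_mod_cast this

/-- The DTW value of the OV instance is at most `(|x| + |y|) M₂`. [folklore] -/
theorem toNat_dtwDist_ov_le (I : OVInstance) :
    (dtwDist (ovX I) (ovY I)).toNat ≤ ((ovX I).length + (ovY I).length) * M₂ I.d := by
  have hx : ovX I ≠ [] := ga_ne_nil _ (params₃ I.d).1 _
  have hy : ovY I ≠ [] := ga_ne_nil _ (params₃ I.d).1 _
  have h := dtwDist_le_length_mul (B := M₂ I.d) hx hy (fun v hv => ov_vals I v hv)
  have hne := dtwDist_ov_ne_top I
  rw [← ENat.coe_toNat hne] at h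
  exact_mod_cast h

/-! ### The OV algorithm, and fine-grained.S15 (DTW) -/

/-- An orthogonal pair needs `n ≥ 1`. [folklore] -/
theorem one_le_n_of_hasOrthogonalPair {I : OVInstance} (h : I.HasOrthogonalPair) : 1 ≤ I.n := by
  obtain ⟨i, -⟩ := h; exact i.pos

/-- **A subquadratic algorithm for DTW on one-dimensional curves solves OV in `n^{2-ε} poly(d)`
time** (K. Bringmann, M. Künnemann, FOCS 2015, Thm. 3.3 with the DTW gadgets of §6 — Lemmas 6.2,
6.3, 6.6 — read on the word RAM): if for some `0 < ε ≤ 1` and `c ≥ 1` the problem `DTW c`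
(one-dimensional curves of natural numbers at most `N^c`, `N = |x| + |y|`) has a deterministic
`O(N^{2-ε})`-time word-RAM algorithm, then Orthogonal Vectors is decided on the deterministic word
RAM within `⌊C' ((n+1)^{2-ε} (d+1)^2)⌋₊` steps (`OVInTimePolyDim ε`). Proof: the program
`DTWRed.Prog.reduction` writes the curves `ovX I`, `ovY I` of `DTWOVGadgets` (`|x| + |y| ≤
2000 (n+1)(d+1)`, entries `≤ M₂ ≤ |x|`, so an instance of every `DTW c`, `c ≥ 1`), runs the DTW
program on them as an emulated sub-run at its own word size, and accepts iff the returned distance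
is at most `thr I` (`DTWRed.toNat_dtwDist_ov_le_thr_iff`; the empty instance `n = 0` is rejected).
[cite: BringmannKunnemannFOCS2015, Thm. 3.3 (proof §3.1) with §6 Lemmas 6.2, 6.3, 6.6; Thm. 1.1] -/
theorem ovInTimePolyDim_of_dtw_inTimeO {ε : ℝ} (hε : 0 < ε) (hε1 : ε ≤ 1) {c : ℕ} (hc : 1 ≤ c)
    (h : (DTW c).InTimeO fun N => (N : ℝ) ^ (2 - ε)) : OVInTimePolyDim ε := by
  obtain ⟨C, M, k, hdet, hof, hM⟩ := h
  refine ⟨101006 + 152000038 * max C 0, 2, Prog.reduction M k, Prog.kfit k M.maxConst,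
    Prog.reduction_isDeterministic _ _, Prog.reduction_isOracleFree _ _, fun (I : OVInstance) => ?_⟩
  set g : Prog.Params := ⟨I, k, M.maxConst⟩ with hg
  -- the DTW program on the instance
  obtain ⟨out, hout, hrun⟩ := hM (ovDTWInst c hc I)
  rw [good_ovDTWInst, Set.mem_singleton_iff] at hout
  subst hout
  set v : ℕ := (dtwDist (ovX I) (ovY I)).toNat with hv
  have hws : k * (DTW c).width (ovDTWInst c hc I) = g.ws := by rw [width_ovDTWInst]; rfl
  have hy : (DTW c).encode (ovDTWInst c hc I) = g.y := rfl
  have hsz : (DTW c).size (ovDTWInst c hc I) = g.lenX + g.lenY := rfl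
  simp only [hws, hy, hsz] at hrun
  obtain ⟨hF, hNyM2⟩ := g.fits
  have hvW : v + 1 < 2 ^ (Prog.kfit g.kD g.cD * inputWidth g.x) := by
    have h1 := toNat_dtwDist_ov_le I
    have h2 : ((ovX I).length + (ovY I).length) * M₂ I.d ≤ g.Ny * g.M2 :=
      Nat.mul_le_mul_right _ (by show _ ≤ (ovX I).length + (ovY I).length + 1; omega)
    omega
  have key := g.reduction_outputsWithin hF hdet hof rfl hvW hrun
  refine ⟨[if v + 1 < g.thr' then 1 else 0], ?_, key.mono (Nat.le_floor (g.Ttotal_le hε hε1 C))⟩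
  rw [DiamRed.OV_good_eq, Set.mem_singleton_iff]
  by_cases hp : I.HasOrthogonalPair
  · have hn : 1 ≤ I.n := one_le_n_of_hasOrthogonalPair hp
    rw [if_pos hp, if_pos ((g.lt_thr'_iff v).2 ⟨hn, (toNat_dtwDist_ov_le_thr_iff I hn).2 hp⟩)]
  · rw [if_neg hp, if_neg (fun hlt => ?_)]
    obtain ⟨hn, hle⟩ := (g.lt_thr'_iff v).1 hlt
    exact hp ((toNat_dtwDist_ov_le_thr_iff I hn).1 hle)

end DTWRed

/-- **OVH ⇒ fine-grained.S15 for DTW** (Bringmann–Künnemann, FOCS 2015, Thm. 1.1 with SETH replaced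
by the Orthogonal-Vectors hypothesis OVH as the authors allow, §2.1): if for no `ε > 0` Orthogonal
Vectors is in deterministic word-RAM time `O((n+1)^{2-ε} (d+1)^c)` (`OVHWordRAM`), then for every
`c ≥ 1` and `ε > 0` there is no deterministic `O(N^{2-ε})`-time word-RAM algorithm for `DTW c`.
(Shrink `ε` to `min ε 1` first.) [cite: BringmannKunnemannFOCS2015, Thm. 1.1 with §2.1] -/
theorem not_dtw_inTimeO_of_ovhWordRAM (h : OVHWordRAM) (c : ℕ) (hc : 1 ≤ c) (ε : ℝ) (hε : 0 < ε) :
    ¬ (DTW c).InTimeO fun n => (n : ℝ) ^ (2 - ε) := by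
  intro hA
  have hA₁ := inTimeO_rpow_two_sub_anti (min_le_left ε 1) hA
  exact h (min ε 1) (lt_min hε one_pos)
    (DTWRed.ovInTimePolyDim_of_dtw_inTimeO (lt_min hε one_pos) (min_le_right ε 1) hc hA₁)

/-- **Assembly of fine-grained.S15 (DTW) in the word-RAM model.** Williams' split-and-list reduction
on the word RAM (`kSATInRAMTime_of_ovInTimePolyDim`: word-RAM SETH ⇒ OVH,
`ovhWordRAM_of_sethWordRAM_of`) and the OV-to-DTW reduction proved here give the named fact
`not_dtw_inTimeO_of_sethWordRAM` verbatim. [cite: BringmannKunnemannFOCS2015, Thm. 1.1 and Lemma 2.1] -/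
theorem not_dtw_inTimeO_of_sethWordRAM_of (hY : kSATInRAMTime_of_ovInTimePolyDim) :
    not_dtw_inTimeO_of_sethWordRAM :=
  fun hSETH c hc ε hε => not_dtw_inTimeO_of_ovhWordRAM (ovhWordRAM_of_sethWordRAM_of hY hSETH) c hc ε hε

/-- **fine-grained.S15 for DTW, discharged** (K. Bringmann, M. Künnemann, *Quadratic conditional
lower bounds for string problems and dynamic time warping*, FOCS 2015, **Thm. 1.1**: "DTW on
one-dimensional curves whose points take values in `{0, …, O(n)}` has no `O(n^{2-ε})` algorithm for
any `ε > 0`, unless SETH fails" — the statement file cites it as Thm. 1.2 and, for curves of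
symbols, Abboud–Backurs–Vassilevska Williams, FOCS 2015, Thm. 1). Assuming word-RAM SETH, for every
`c ≥ 1` and `ε > 0` there is no deterministic `O(N^{2-ε})`-time word-RAM program for `DTW c`
(one-dimensional curves with entries at most `N^c`; the instances built here have entries
`≤ 48(d+1) + … ≤ |x| ≤ N`, inside every `DTW c`). Proof: word-RAM SETH ⇒ OVH by Williams'
split-and-list reduction in polynomial dimension (`kSATInRAMTime_of_ovInTimePolyDim_holds`,
`OVPolyDimProofs.lean`; BK15 Lemma 2.1), and OVH ⇒ no subquadratic DTW by the reduction of this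
file (`DTWRed.ovInTimePolyDim_of_dtw_inTimeO`: coordinate/vector gadgets `DTWCoordinateGadget`,
alignment gadget with its two-sided analysis `DTWAlignmentGadget`, normalised vector gadgets and the
OV curves `DTWOVGadgets`, the word-RAM program `DTWReductionProgram`/`DTWReductionLoops`); all in
the one machine model of the sources, the word RAM.
[cite: BringmannKunnemannFOCS2015, Thm. 1.1 (= Thm. 3.3 + §6 + Lemma 2.1)]
[cite: AbboudBackursVassilevskaWilliamsFOCS2015, Thm. 1 (DTW over symbols; cf.)] -/
theorem not_dtw_inTimeO_of_sethWordRAM_holds : not_dtw_inTimeO_of_sethWordRAM :=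
  not_dtw_inTimeO_of_sethWordRAM_of kSATInRAMTime_of_ovInTimePolyDim_holds

end Literature.Computability.FineGrained
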